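import Summits.AnomalousDissipation.AnomalousDissipation.Theorems.BaireTransferRobustLoudUpgradeLine
import Summits.AnomalousDissipation.AnomalousDissipation.Theorems.BaireTransferRobustLoudUpgradeStubSteadyPersist
import Summits.AnomalousDissipation.AnomalousDissipation.Theorems.BaireTransferRobustLoudUpgradeStubPeriodicWindow
import Summits.AnomalousDissipation.AnomalousDissipation.Theorems.BaireTransferRobustLoudUpgradePeriodicPersistOfHenry
import Literature.Analysis.FluidPDE.PeriodicNSOrbitPersistsProofs
import Literature.Analysis.FluidPDE.LongTimeAverageNonneg

/-!
# Stub `stub_limitEquation` of the line `malkin-cone-group-orbits`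
# (crux stmt-AnomalousDissipation-1144, `BaireTransfer.RobustLoudUpgrade`, lead c16, lattice-tempered windows)

The projected time-periodic Navier–Stokes lattice equation (space–time Fourier side, files
`Literature/Analysis/FluidPDE/TimePeriodicNSLattice*.lean`, `PeriodicNSOrbitPersistsProofs.lean`)
passes to the limit MODE BY MODE along a sequence of states `x_i → x` converging in norm in the Hilbert
space `W`, with convergent frequencies `om_i → om`, viscosities `ν_i → ν`, means `m_i → m` and force
coefficients `c_i → c`: for a fixed mode `(n, k)`, `k ≠ 0`, every term of
`σ_{om,ν,m}(n,k) û(n,k) + P_k N(û, û)(n,k) = y_{f_c}(n,k)` is continuous in the data — the symbol is a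
polynomial in `(om, ν, m)`, the coordinate `x ↦ x(n,k)` is continuous on `ℓ²`, the convective
coordinate is a coordinate of the bounded bilinear map `B` of `TimePeriodicLattice.exists_bilinear`, and
the force coefficient is `sup`-norm continuous in `c` (`‖𝓕(g)(k)‖ ≤ sup ‖g‖` with
`PeriodicPersistOfHenry.exists_forall_norm_force_sub_le`) — so both sides converge and the limits agree
(`tendsto_nhds_unique`).

References: G. Iooss, Arch. Rational Mech. Anal. 47 (1972) 301–329; D. Henry, *Geometric Theory of
Semilinear Parabolic Equations*, LNM 840 (1981), Ch. 8; the vocabulary module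
`Theorems/BaireTransferRobustLoudUpgradeLine.lean`; patterns from
`Literature/Analysis/FluidPDE/PeriodicNSOrbitPersistsProofs.lean` (`yf_sub`, `tsum_enorm_yf_sq_le`).
-/

set_option linter.dupNamespace false

noncomputable section

open scoped BigOperators Topology ENNReal NNReal ComplexConjugate
open Filter Set Function TopologicalSpace MeasureTheory UnitAddTorus

namespace Summit.AnomalousDissipation.AnomalousDissipation.Theorems.RobustLoudUpgrade.Tempered

open Literature.Analysis.FunctionSpaces Literature.Analysis.FunctionSpaces.Torus
open Literature.Analysis.FunctionSpaces.EuclideanSpace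
open Literature.Analysis.FluidPDE Literature.Analysis.FluidPDE.ScalarFourier
open Literature.Analysis.FluidPDE.TimePeriodicLattice
open Summit.AnomalousDissipation.AnomalousDissipation.Theses.BaireTransfer
open Summit.AnomalousDissipation.AnomalousDissipation.Theorems.RobustLoudUpgrade

-- NOTATION START (verbatim the local notations of `Literature/Analysis/FluidPDE/PeriodicNSOrbitPersistsProofs.lean`)
/-- The flat unit torus `T³`. -/
local notation "𝕋³" => UnitAddTorus (Fin 3)
/-- Real velocity values. -/
local notation "ℝ³" => EuclideanSpace ℝ (Fin 3)
/-- Complex coefficient values. -/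
local notation "ℂ³" => EuclideanSpace ℂ (Fin 3)

/-- Local notation: the parabolic weight `Λ(n, k) = |n| + |k|²`. -/
local notation:max "Λ" m:max => (|((Prod.fst m : ℤ) : ℝ)| + freqNormSq (Prod.snd m))

/-- Local notation: the convective symbol on `ℤ × ℤ³` (as in `TimePeriodicNSLattice`). -/
local notation:max "𝐍[" a ", " b "]" m:max =>
  (WithLp.toLp 2 (fun p : Fin 3 => ∑ j : Fin 3, ∑' m' : ℤ × (Fin 3 → ℤ),
    a m' j * (dsym j (Prod.snd m - Prod.snd m') * b (m - m') p)) : EuclideanSpace ℂ (Fin 3))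

/-- Local notation: division by the weight. -/
local notation:max "𝐜" x:max => (fun mm : ℤ × (Fin 3 → ℤ) =>
  ((((|((Prod.fst mm : ℤ) : ℝ)| + freqNormSq (Prod.snd mm))⁻¹ : ℝ) : ℂ) • x mm))

/-- Local notation: multiplication by the weight. -/
local notation:max "𝐬" x:max => (fun mm : ℤ × (Fin 3 → ℤ) =>
  ((((|((Prod.fst mm : ℤ) : ℝ)| + freqNormSq (Prod.snd mm)) : ℝ) : ℂ) • x mm))

/-- Local notation: the family of coefficients of `x ∈ W ⊂ ℓ²`. -/
local notation:max "𝐰" x:max =>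
  (((x : lp (fun _ : ℤ × (Fin 3 → ℤ) => EuclideanSpace ℂ (Fin 3)) 2)) : ℤ × (Fin 3 → ℤ) → EuclideanSpace ℂ (Fin 3))

/-- Local notation: the symbol `σ_om(n,k) = 2πi om n + 4π²ν|k|² + 2πi m₀·k`. -/
local notation "σ[" om ", " ν ", " m₀ "]" => (fun mm : ℤ × (Fin 3 → ℤ) =>
  2 * Real.pi * Complex.I * ((om : ℝ) : ℂ) * ((Prod.fst mm : ℤ) : ℂ) +
    (((4 * Real.pi ^ 2 * ν * freqNormSq (Prod.snd mm) : ℝ)) : ℂ) +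
    2 * Real.pi * Complex.I * (∑ jj : Fin 3, ((m₀ jj : ℝ) : ℂ) * (((Prod.snd mm) jj : ℤ) : ℂ)))

/-- Local notation: the lattice family of the orbit `u` with period `τ`:
`û(n,k) = 𝓕(complexify ∘ (timeRoll τ u − ∫ u(0)))(n,k)`. -/
local notation:max "𝐨[" τ ", " u "]" => (fun mm : ℤ × (Fin 3 → ℤ) =>
  mFourierCoeff (EuclideanSpace.complexify ∘ fun y : UnitAddTorus (Fin 4) => Torus.timeRoll τ u y - ∫ x, u 0 x)
    (Fin.cons (Prod.fst mm) (Prod.snd mm) : Fin 4 → ℤ))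

/-- Local notation: the force family `y_F(n,k) = [k ≠ 0][n = 0] 𝓕(complexify ∘ F)(k)`. -/
local notation:max "𝐲" F:max => (fun mm : ℤ × (Fin 3 → ℤ) =>
  (ite (Prod.snd mm = 0) (0 : EuclideanSpace ℂ (Fin 3))
    (ite (Prod.fst mm = 0) (mFourierCoeff (EuclideanSpace.complexify ∘ F) (Prod.snd mm)) 0)))
-- NOTATION END

variable {W : Submodule ℝ (lp (fun _ : ℤ × (Fin 3 → ℤ) => EuclideanSpace ℂ (Fin 3)) 2)}

/-! ## Auxiliary continuity statements, one per term of the equation -/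

namespace stub_limitEquationAux

/-- The symbol `σ_{om,ν,m₀}(n,k)` is continuous in `(om, ν, m₀)` for a fixed mode: along convergent
sequences of frequencies, viscosities and means it converges. [folklore] -/
theorem tendsto_symbol (m : ℤ × (Fin 3 → ℤ)) {oms νs : ℕ → ℝ} {oml νl : ℝ}
    (hom : Tendsto oms atTop (𝓝 oml)) (hν : Tendsto νs atTop (𝓝 νl)) {ms : ℕ → ℝ³} {ml : ℝ³}
    (hm : Tendsto ms atTop (𝓝 ml)) :
    Tendsto (fun i => σ[oms i, νs i, ms i] m) atTop (𝓝 (σ[oml, νl, ml] m)) := by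
  beta_reduce
  refine (Tendsto.add ?_ ?_).add ?_
  · exact (tendsto_const_nhds.mul ((Complex.continuous_ofReal.tendsto _).comp hom)).mul
      tendsto_const_nhds
  · exact (Complex.continuous_ofReal.tendsto _).comp
      ((tendsto_const_nhds.mul hν).mul tendsto_const_nhds)
  · exact tendsto_const_nhds.mul (tendsto_finsetSum _ fun jj _ =>
      ((Complex.continuous_ofReal.tendsto _).comp
        (((PiLp.continuous_apply 2 _ jj).tendsto _).comp hm)).mul tendsto_const_nhds)

/-- The weighted coordinate `x ↦ x(n,k)/Λ(n,k)` is continuous on `W`. [folklore] -/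
theorem continuous_cw_apply (m : ℤ × (Fin 3 → ℤ)) : Continuous fun x : W => (𝐜 (𝐰 x)) m :=
  ((l2_continuous_apply m).comp continuous_subtype_val).fun_const_smul _

/-- The diagonal `x ↦ B(x,x)(n,k)` of a bounded bilinear map on `W` is continuous, coordinatewise. [folklore] -/
theorem continuous_bil_diag_apply {B : W → W → W}
    (hBb : IsBoundedBilinearMap ℝ (fun p : W × W => B p.1 p.2)) (m : ℤ × (Fin 3 → ℤ)) :
    Continuous fun x : W => (𝐰 (B x x)) m :=
  (l2_continuous_apply m).comp
    (continuous_subtype_val.comp (hBb.continuous.comp (continuous_id.prodMk continuous_id)))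

/-- `‖y_G(n,k)‖ ≤ sup ‖G‖`: a single coefficient of the force family is bounded by the sup norm of
the force (`‖𝓕(g)(k)‖ ≤ sup ‖g‖`, `complexify` is an isometry). [folklore] -/
theorem norm_yf_le {G : 𝕋³ → ℝ³} {C : ℝ} (hC : ∀ x, ‖G x‖ ≤ C) (m : ℤ × (Fin 3 → ℤ)) :
    ‖(𝐲 G) m‖ ≤ C := by
  have hC0 : 0 ≤ C := (norm_nonneg _).trans (hC 0)
  beta_reduce
  split_ifs
  · rwa [norm_zero]
  · exact norm_mFourierCoeff_le_of_forall_norm_le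
      (fun x => (norm_complexify (G x)).trans_le (hC x)) _
  · rwa [norm_zero]

/-- **The force coefficient is continuous in `c`**: `y_{f_{c_i}}(n,k) → y_{f_c}(n,k)` whenever
`c_i → c` (sup-norm continuity of `c ↦ f_c`, `PeriodicPersistOfHenry.exists_forall_norm_force_sub_le`,
and `norm_yf_le` applied to `f_{c_i} − f_c`). [folklore] -/
theorem tendsto_yf_force {S : Finset (Fin 3 → ℤ)} {cs : ℕ → Coeff S} {cl : Coeff S}
    (hc : Tendsto cs atTop (𝓝 cl)) (m : ℤ × (Fin 3 → ℤ)) :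
    Tendsto (fun i => (𝐲 (force S (cs i))) m) atTop (𝓝 ((𝐲 (force S cl)) m)) := by
  rw [Metric.tendsto_atTop]
  intro ε hε
  obtain ⟨ρ, hρ, hball⟩ := PeriodicPersistOfHenry.exists_forall_norm_force_sub_le cl (half_pos hε)
  obtain ⟨N, hN⟩ := Metric.tendsto_atTop.1 hc ρ hρ
  refine ⟨N, fun i hi => ?_⟩
  rw [dist_eq_norm, yf_sub (SteadyPersist.isSmooth_force' (cs i)).continuous
    (SteadyPersist.isSmooth_force' cl).continuous m]
  exact (norm_yf_le (hball (cs i) (hN i hi)) m).trans_lt (half_lt_self hε)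

end stub_limitEquationAux

open stub_limitEquationAux in
/-- **The projected lattice equation passes to the limit, mode by mode.**  If states `x_i → x` in norm
in `W`, frequencies `om_i → om`, viscosities `ν_i → ν`, means `m_i → m` and coefficients `c_i → c`, and
each `û_i = x_i/Λ` solves `σ_{om_i,ν_i,m_i} û_i + P N(û_i, û_i) = y_{f_{c_i}}` off the zero spatial
modes, then so does `û = x/Λ` with the limit data: for a fixed mode every term is continuous in the data
(`tendsto_symbol`, `continuous_cw_apply`, the bounded bilinear map of `exists_bilinear`,
`tendsto_yf_force`), and limits are unique. [folklore] -/
theorem stub_limitEquation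
    (hW : ∀ x : lp (fun _ : ℤ × (Fin 3 → ℤ) => EuclideanSpace ℂ (Fin 3)) 2, x ∈ W ↔
      (∀ n : ℤ, (x : ℤ × (Fin 3 → ℤ) → EuclideanSpace ℂ (Fin 3)) (n, 0) = 0) ∧
      (∀ mm : ℤ × (Fin 3 → ℤ), (∑ jj : Fin 3, ((mm.2 jj : ℤ) : ℂ) *
        ((x : ℤ × (Fin 3 → ℤ) → EuclideanSpace ℂ (Fin 3)) mm) jj) = 0) ∧
      (∀ mm : ℤ × (Fin 3 → ℤ), (x : ℤ × (Fin 3 → ℤ) → EuclideanSpace ℂ (Fin 3)) (-mm) =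
        conjVec ((x : ℤ × (Fin 3 → ℤ) → EuclideanSpace ℂ (Fin 3)) mm)))
    {S : Finset (Fin 3 → ℤ)} (xs : ℕ → W) (xl : W) (hx : Tendsto xs atTop (𝓝 xl))
    (oms νs : ℕ → ℝ) (oml νl : ℝ) (hom : Tendsto oms atTop (𝓝 oml)) (hν : Tendsto νs atTop (𝓝 νl))
    (ms : ℕ → ℝ³) (ml : ℝ³) (hm : Tendsto ms atTop (𝓝 ml))
    (cs : ℕ → Coeff S) (cl : Coeff S) (hc : Tendsto cs atTop (𝓝 cl))
    (heq : ∀ i : ℕ, ∀ m : ℤ × (Fin 3 → ℤ), m.2 ≠ 0 →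
      σ[oms i, νs i, ms i] m • (𝐜 (𝐰 (xs i))) m + Torus.lerayCoeff m.2 (𝐍[𝐜 (𝐰 (xs i)), 𝐜 (𝐰 (xs i))] m) =
        (𝐲 (force S (cs i))) m) :
    ∀ m : ℤ × (Fin 3 → ℤ), m.2 ≠ 0 →
      σ[oml, νl, ml] m • (𝐜 (𝐰 xl)) m + Torus.lerayCoeff m.2 (𝐍[𝐜 (𝐰 xl), 𝐜 (𝐰 xl)] m) =
        (𝐲 (force S cl)) m := by
  intro m hm2
  obtain ⟨B, hBf, hBb⟩ := exists_bilinear hW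
  -- the convective coordinate is the `m`-th coordinate of the continuous map `x ↦ B(x,x)`
  have hB : Tendsto (fun i => (𝐰 (B (xs i) (xs i))) m) atTop (𝓝 ((𝐰 (B xl xl)) m)) :=
    ((continuous_bil_diag_apply hBb m).tendsto xl).comp hx
  have hN : Tendsto (fun i => Torus.lerayCoeff m.2 (𝐍[𝐜 (𝐰 (xs i)), 𝐜 (𝐰 (xs i))] m)) atTop
      (𝓝 (Torus.lerayCoeff m.2 (𝐍[𝐜 (𝐰 xl), 𝐜 (𝐰 xl)] m))) := by
    rw [← hBf xl xl m]
    exact hB.congr fun i => hBf _ _ _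
  -- the left-hand sides converge
  have hL : Tendsto (fun i => σ[oms i, νs i, ms i] m • (𝐜 (𝐰 (xs i))) m +
      Torus.lerayCoeff m.2 (𝐍[𝐜 (𝐰 (xs i)), 𝐜 (𝐰 (xs i))] m)) atTop
      (𝓝 (σ[oml, νl, ml] m • (𝐜 (𝐰 xl)) m + Torus.lerayCoeff m.2 (𝐍[𝐜 (𝐰 xl), 𝐜 (𝐰 xl)] m))) :=
    ((tendsto_symbol m hom hν hm).smul (((continuous_cw_apply m).tendsto xl).comp hx)).add hN
  -- so do the right-hand sides, and the two sequences coincide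
  have hL' : Tendsto (fun i => (𝐲 (force S (cs i))) m) atTop
      (𝓝 (σ[oml, νl, ml] m • (𝐜 (𝐰 xl)) m + Torus.lerayCoeff m.2 (𝐍[𝐜 (𝐰 xl), 𝐜 (𝐰 xl)] m))) :=
    hL.congr fun i => heq i m hm2
  exact tendsto_nhds_unique hL' (tendsto_yf_force hc m)

end Summit.AnomalousDissipation.AnomalousDissipation.Theorems.RobustLoudUpgrade.Tempered

end
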